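import Literature.MathematicalPhysics.QuantumFieldTheory.Balaban1983to89.Node00.CarriersB8SubBH
import Literature.MathematicalPhysics.QuantumFieldTheory.Balaban1983to89.B8LeafModelZd3P

/-!
# NODE 00 (YM-PLAN Track A) — STAGE 3′(X.B8″P): THE [Balaban1985RegularSpaces] SUB-FAMILY PIN ON THE P-CARRIER — the [B8] group of record over n05-c's four-law
# sub-index `IdxB8SubB θ` with its members read at `B8LeafModelZd3P.zdGF3HP` (the (1.35) ∕ (1.66), (1.37) ∕ (1.42) and hence (1.145) letters in PRINT'S bond classes:
# one-end-point class «on Λ_j ∕ on Ω_j^{(j)}», constraint-bond class (1.31) incl. the crossing contours; Theorem 8's source space as printed), the surviving leaf over it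
# (`B8LeafOfRecordSubBP`), its reading as «the four class-free conjuncts of the old pin ∧ Thm 2 ∕ Prop 3 ∕ Thm 4 ∕ Prop 7 ∕ Thm 8 AT THE P-MEMBERS», the carrier laws,
# the cut layer, and the rejection of the refuting sources of record

[Balaban1985RegularSpaces] = T. Bałaban, *Spaces of regular gauge field configurations on a lattice and gauge fixing conditions*, Commun. Math. Phys. **99**
(1985) 75–102 — Lemma 1 p. 79, Thm 2 p. 83, Prop. 3 p. 87, Thm 4 p. 88, Props. 5–7 pp. 94–100, Thm 8 p. 101; (1.31) ∕ (1.35) ∕ (1.37) p. 82, (1.42) p. 83, (1.66) p. 88,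
(1.145) p. 100, p. 77 (bond convention «at least one end-point of b belongs to Ω»).  [Balaban1984PropagatorsII] (2.3) p. 224.  PDF held:
`paper:balaban1985-cmp99-regular-spaces-gauge-fixing` (journal page = PDF page + 74).

WHY THIS MODULE (width seat `pub-ymgap-dag-n05-w1` g0, 2026-08-28, on the row's -d lane's word (dag-n05-d g10, cell bus l.24729: «then node00-def (or you on their silence)
re-pins») after plan g78's carrier-edition word (l.24332 ∕ l.24376); APPEND-ONLY: a NEW importing module — n05-c g6's `Node00/CarriersB8SubBH`, this seat's `B8LeafModelZd3P`
and everything below them are untouched and CONSUMED BY NAME).  dag-n05-d g10's kernel certificate `B8Prop3ShellModeVacuity.not_b8LeafOfRecordSubBH` (p585094) shows that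
the [B8″H] slot of record `Node00.B8LeafOfRecordSubBH θ λ` is UNINHABITED for every admissible `θ` (`θ.D ≥ 2`) and EVERY residual layer `λ`: its Proposition-3 conjunct `p3`
reads the (1.42) HYPOTHESIS of Prop. 3 (`zdGF3.C137`) on the member's law class `i.Λb = towerBonds …`, which contains NO level-`j ≥ 1` crossing bond, so an interior shell
gauge mode passes every typed hypothesis and violates (1.36)₁ — typed Prop. 3 is STRONGER than print's.  The repair is in the tree as the carrier `B8LeafModelZd3P.zdGF3HP`
(p588746: `zdGF3H` with the THREE class-sensitive letters re-read as printed — (1.37) ∕ (1.42) `C137` over dag-n05-d's `B8TowerBondsPrinted.towerBondsP` ((1.31) incl. the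
crossing contours), (1.35) ∕ (1.66) `avgClose` ∕ `avgClose166` in print's p. 77 one-end-point class `EndBlockIn` — every other field `rfl`-equal; design converged on the
bus with dag-n05-d and n05-w2, l.24816 ∕ l.25334 ∕ l.25404).  What the N05 line lacks is THE PIN: the [B8] group of record READ AT THE P-MEMBERS.  This file types it —
letter for letter n05-c g6's `CarriersB8SubBH` §1–§5 with `famB8OfRecordSubBH ↦ famB8OfRecordSubBP` — and records the one fact every consumer needs: **the P-leaf is
the FOUR class-free conjuncts of the old pin (Lemma 1, Prop. 5 ∃, Prop. 5 !, Prop. 6 — unchanged statements, so every landed supplier transfers by `exact`) together with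
Theorem 2 ∕ Proposition 3 ∕ Theorem 4 ∕ Proposition 7 ∕ Theorem 8 AT THE P-MEMBERS** (`b8LeafOfRecordSubBP_iff_classFree_and_P`) — the targets of the γ D-chain (D5 ∕ D3 ∕
D4 ∕ p7γ ∕ D7-3) on `zdGF3P` ∕ `zdGF3HP`.

* §1 `famB8OfRecordSubBP θ β len i := zdGF3HP θ.𝔸 θ.L β len i.1.1` (SAME index `IdxB8SubB θ`); its `GFData2` ∕ `GFData` faces ARE `zdGF3P`'s, its (1.140) ∕ `LandauF` ∕
  Lemma-1-side faces the old pin's, its `InR` the H-pin's (all `rfl`); the R-extension law `proj140` and the carrier law (1.36) ⊂ (1.62) on it (g31's proofs BY NAME —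
  they read (1.140), (1.62), (1.36) only, all unchanged); NEW ⇒ OLD for the three re-typed letters at the pin (`C137_famB8OfRecordSubB_of_subBP`, `avgClose…`).
* §2 **`PrintedCarriersR.withB8OfRecordSubBP X θ λ`** — `withB8OfRecordSubBH` VERBATIM with the family ↦ `famB8OfRecordSubBP` (SAME residual layer `λ : ResidB8 θ`;
  Proposition 7's axial map `fun j => λ.toAxial j.1` typechecks unchanged: the P-members' `Cfg` ∕ `Pert` are the old ones by `rfl`);
  **`B8LeafOfRecordSubBP θ λ`** — the surviving leaf `B8LeafRS` over the P-sub-family; `b8LeafRS_withB8OfRecordSubBP_iff` (`Iff.rfl`); the `rfl` commuting faces.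
* §3 THE READING: `b8LeafOfRecordSubBP_iff_classFree_and_P` and the constructor `b8LeafOfRecordSubBP_of_fields`; NO «OLD ⇒ NEW» or «NEW ⇒ OLD» at the slot
  (`C137` and `avgClose` sit in both variances — `B8LeafModelZd3P` header (iii)); typed ⇒ surviving `b8LeafOfRecordSubBP_of_b8LeafR`; the projections `.t8HP`, `.p3P`, `.t4P`.
* §4 THE CUT LAYER (dag-n05-d's `ResidB8.cutSubB`, REUSED — no new definition): `b8LeafOfRecordSubBP_cutSubB_iff` (`Iff.rfl`) and its reading.
* §5 NON-VACUITY OF THE SOURCE READING AT THE PIN (as at the H-pin, same `InR`): the index is inhabited; the two refuting sources of record are REJECTED at every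
  member (`not_inR_famB8OfRecordSubBP_of_not_isSelfAdjoint`, `…_of_not_bdd`), and `f = 0` is admitted (`inR_famB8OfRecordSubBP_zero`).

HONEST FRAMING: DEFINITIONS and `rfl` ∕ by-name bookkeeping only — nothing of [Balaban1985RegularSpaces] is asserted or discharged here; whether Thm 2 ∕ Prop 3 ∕ Thm 4 ∕
Prop 7 ∕ Thm 8 HOLD at the P-members is the γ D-chain's content (dag-n05-d D3 ∕ D7, n05-w2 D4 ∕ D5, n05-w3 D6), not claimed; the record re-key (`Record13CarriersB8SubBH* →
…SubBP`) is NODE 00's ∕ the planners' (K1⁷ v6 host trigger, plan g78 (β)), not this file's; N05 NOT discharged; counts unmoved; one finite T⁴ programme at fixed ε,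
Bałaban as printed — NOT continuum ∕ ℝ⁴ ∕ infinite volume ∕ OS ∕ mass gap ∕ Clay.  No `sorry`, no `axiom`, no `opaque`, no `instance`, no `notation`. -/

noncomputable section

namespace Literature.MathematicalPhysics.QuantumFieldTheory.Balaban1983to89.Node00

open DagBinding
open B8LeafKnitRS (B8LeafRS)
open B8LeafModelZd (ZdIdx)
open B8LeafModelZd3 (zdGF3)
open B8LeafModelZd3H (zdGF3H)
open B8LeafModelZd3P (zdGF3P zdGF3HP)
open B8Lemma1NonAbelian (blockPairNA)
open B8IdxB8LawsB (IdxB8LawsB IdxB8SubB famB8OfRecordSubB)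

/-! ## §1. The [B8] sub-family of record READ AT THE P-MEMBERS; its `rfl` faces; the two carrier laws; NEW ⇒ OLD for the re-typed letters -/

section FamilyP

variable (θ : Stage3Params)

/-- **THE [B8] SUB-FAMILY OF RECORD AT THE P-MEMBERS**: member `i` of n05-c's four-law sub-index `IdxB8SubB θ` ↦ `zdGF3HP θ.𝔸 θ.L β len i.1.1` — n05-a's member of record
with (1.35) ∕ (1.66), (1.37) ∕ (1.42) read in print's bond classes and Theorem 8's source space read as printed; every other carrier and predicate of the member unchanged.
[cite: Balaban1985RegularSpaces, (1.31) p.82, (1.35) p.82, (1.37) p.82, (1.42) p.83, (1.66) p.88, p.77, Thm 8 (1.146) p.101; Balaban1984PropagatorsII, (2.3) p.224] -/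
def famB8OfRecordSubBP (β : ℝ) (len : B7Prop1Explicit.Site θ.D → ℝ) (i : IdxB8SubB θ) : B8SectGH.GFData3 :=
  zdGF3HP θ.𝔸 θ.L β len i.1.1

variable {θ}

/-- The P-member unfolded to the P-carrier through `Subtype.val` twice (`rfl`). [cite: Balaban1985RegularSpaces, p.77 (bookkeeping)] -/
theorem famB8OfRecordSubBP_eq (β : ℝ) (len : B7Prop1Explicit.Site θ.D → ℝ) (i : IdxB8SubB θ) :
    famB8OfRecordSubBP θ β len i = zdGF3HP θ.𝔸 θ.L β len i.1.1 := rfl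

/-- The P-member's `GFData2` part (Lemma 1 – Prop. 6 letters, incl. the re-typed (1.35) ∕ (1.66) ∕ (1.37)) IS `zdGF3P`'s (`rfl`).
[cite: Balaban1985RegularSpaces, (1.33)–(1.40) pp.82–83 (bookkeeping)] -/
theorem famB8OfRecordSubBP_toGFData2 (β : ℝ) (len : B7Prop1Explicit.Site θ.D → ℝ) (i : IdxB8SubB θ) :
    (famB8OfRecordSubBP θ β len i).toGFData2 = (zdGF3P θ.𝔸 θ.L β len i.1.1).toGFData2 := rfl

/-- The P-member's `GFData` part IS `zdGF3P`'s (`rfl`). [cite: Balaban1985RegularSpaces, (1.33)–(1.39) p.82 (bookkeeping)] -/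
theorem famB8OfRecordSubBP_toGFData (β : ℝ) (len : B7Prop1Explicit.Site θ.D → ℝ) (i : IdxB8SubB θ) :
    (famB8OfRecordSubBP θ β len i).toGFData = (zdGF3P θ.𝔸 θ.L β len i.1.1).toGFData := rfl

/-- The carriers `Cfg` ∕ `Pert` at the P-member ARE the old pin's (`rfl` ×2). [cite: Balaban1985RegularSpaces, (1.33)–(1.34) p.82 (bookkeeping)] -/
theorem famB8OfRecordSubBP_Cfg_Pert (β : ℝ) (len : B7Prop1Explicit.Site θ.D → ℝ) (i : IdxB8SubB θ) :
    (famB8OfRecordSubBP θ β len i).Cfg = (famB8OfRecordSubB θ β len i).Cfg ∧ (famB8OfRecordSubBP θ β len i).Pert = (famB8OfRecordSubB θ β len i).Pert :=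
  ⟨rfl, rfl⟩

/-- (1.140) at the P-member IS the old pin's (`rfl`). [cite: Balaban1985RegularSpaces, (1.140) p.100 (bookkeeping)] -/
theorem famB8OfRecordSubBP_C140 (β : ℝ) (len : B7Prop1Explicit.Site θ.D → ℝ) (i : IdxB8SubB θ) :
    (famB8OfRecordSubBP θ β len i).C140 = (famB8OfRecordSubB θ β len i).C140 := rfl

/-- (1.146) `LandauF` at the P-member IS the old pin's (`rfl`). [cite: Balaban1985RegularSpaces, (1.146) p.101 (bookkeeping)] -/
theorem famB8OfRecordSubBP_LandauF (β : ℝ) (len : B7Prop1Explicit.Site θ.D → ℝ) (i : IdxB8SubB θ) :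
    (famB8OfRecordSubBP θ β len i).LandauF = (famB8OfRecordSubB θ β len i).LandauF := rfl

/-- (1.36) ∕ (1.62) ∕ (1.39) ∕ (1.38) at the P-member ARE the old pin's (`rfl` ×4: class-free letters). [cite: Balaban1985RegularSpaces, (1.36)–(1.39) p.82, (1.62) p.87 (bookkeeping)] -/
theorem famB8OfRecordSubBP_C136_C162_C139_Landau (β : ℝ) (len : B7Prop1Explicit.Site θ.D → ℝ) (i : IdxB8SubB θ) :
    (famB8OfRecordSubBP θ β len i).C136 = (famB8OfRecordSubB θ β len i).C136 ∧ (famB8OfRecordSubBP θ β len i).C162 = (famB8OfRecordSubB θ β len i).C162 ∧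
      (famB8OfRecordSubBP θ β len i).C139 = (famB8OfRecordSubB θ β len i).C139 ∧ (famB8OfRecordSubBP θ β len i).Landau = (famB8OfRecordSubB θ β len i).Landau :=
  ⟨rfl, rfl, rfl, rfl⟩

/-- Theorem 8's source membership at the P-member IS the H-pin's (`rfl`: `zdGF3HP.InR := zdGF3H.InR`). [cite: Balaban1985RegularSpaces, Thm 8 (1.146) p.101 (bookkeeping)] -/
theorem famB8OfRecordSubBP_InR (β : ℝ) (len : B7Prop1Explicit.Site θ.D → ℝ) (i : IdxB8SubB θ) :
    (famB8OfRecordSubBP θ β len i).InR = (famB8OfRecordSubBH θ β len i).InR := rfl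

/-- **The source membership «f ∈ R(U₀)» at a member of the P-pin, unfolded** (`Iff.rfl`): `InR138` ∧ Hermitian values ∧ `f = 0` off `Ω₀` ∧ bounded weighted family.
[cite: Balaban1985RegularSpaces, Thm 8 (1.146) p.101, (1.27) p.80, p.86] -/
theorem inR_famB8OfRecordSubBP_iff (β : ℝ) (len : B7Prop1Explicit.Site θ.D → ℝ) (i : IdxB8SubB θ) (U₀ : (famB8OfRecordSubBP θ β len i).Cfg)
    (f : B7Prop1Explicit.Site θ.D → θ.𝔸) :
    (famB8OfRecordSubBP θ β len i).InR U₀ f ↔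
      B8Eq138LandauZd.InR138 θ.L i.1.1.k i.1.1.η (i.1.1.Ω 0) (i.1.1.Λs i.1.1.k) U₀.1 f ∧ (∀ x, IsSelfAdjoint (f x)) ∧ (∀ x, x ∉ i.1.1.Ω 0 → f x = 0) ∧
        B8ScaledSupNorm.Bdd θ.L i.1.1.k i.1.1.η (-(2 : ℝ)) (fun j (x : B7Prop1Explicit.Site θ.D) => x ∈ i.1.1.Ω j) f :=
  Iff.rfl

/-- OLD ⇐ NEW at the membership: the printed «f ∈ R(U₀)» implies the old pin's (its first clause). [cite: Balaban1985RegularSpaces, (1.146) p.101 (bookkeeping)] -/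
theorem inR_famB8OfRecordSubB_of_inR_famB8OfRecordSubBP (β : ℝ) (len : B7Prop1Explicit.Site θ.D → ℝ) (i : IdxB8SubB θ)
    (U₀ : (famB8OfRecordSubBP θ β len i).Cfg) (f : B7Prop1Explicit.Site θ.D → θ.𝔸) (h : (famB8OfRecordSubBP θ β len i).InR U₀ f) :
    (famB8OfRecordSubB θ β len i).InR U₀ f :=
  h.1

/-- **NEW ⇒ OLD for (1.37) ∕ (1.42) at the pin**: the P-member's `C137` (over `towerBondsP`) implies the old pin's (over `i.Λb`); no converse.
[cite: Balaban1985RegularSpaces, (1.31) p.82, (1.37) p.82] -/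
theorem C137_famB8OfRecordSubB_of_subBP (β : ℝ) (len : B7Prop1Explicit.Site θ.D → ℝ) (i : IdxB8SubB θ) {α₁ : ℝ} {U₀ : (famB8OfRecordSubBP θ β len i).Cfg}
    {P : (famB8OfRecordSubBP θ β len i).Pert} (h : (famB8OfRecordSubBP θ β len i).C137 α₁ U₀ P) : (famB8OfRecordSubB θ β len i).C137 α₁ U₀ P :=
  B8LeafModelZd3P.zdGF3P_C137_imp i.1.1 h

/-- **NEW ⇒ OLD for (1.35) at the pin** (one-end-point class ⊇ box-form class); no converse. [cite: Balaban1985RegularSpaces, (1.35) p.82, p.77] -/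
theorem avgClose_famB8OfRecordSubB_of_subBP (β : ℝ) (len : B7Prop1Explicit.Site θ.D → ℝ) (i : IdxB8SubB θ) {α : ℝ} {U₀ : (famB8OfRecordSubBP θ β len i).Cfg}
    {P : (famB8OfRecordSubBP θ β len i).Pert} (h : (famB8OfRecordSubBP θ β len i).avgClose α U₀ P) : (famB8OfRecordSubB θ β len i).avgClose α U₀ P :=
  B8LeafModelZd3P.zdGF3P_avgClose_imp i.1.1 h

/-- **NEW ⇒ OLD for (1.66) at the pin**; no converse. [cite: Balaban1985RegularSpaces, (1.66) p.88, p.77] -/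
theorem avgClose166_famB8OfRecordSubB_of_subBP (β : ℝ) (len : B7Prop1Explicit.Site θ.D → ℝ) (i : IdxB8SubB θ) {α : ℝ} {U₀ : (famB8OfRecordSubBP θ β len i).Cfg}
    {P : (famB8OfRecordSubBP θ β len i).Pert} (h : (famB8OfRecordSubBP θ β len i).avgClose166 α U₀ P) : (famB8OfRecordSubB θ β len i).avgClose166 α U₀ P :=
  B8LeafModelZd3P.zdGF3P_avgClose166_imp i.1.1 h

/-- **THE R-EXTENSION LAW `proj140` HOLDS AT THE P-MEMBERS** (g31's `proj140_famB8OfRecord` BY NAME: it reads (1.140) and (1.62) only, both unchanged).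
[cite: Balaban1985RegularSpaces, (1.140) p.100, (1.62) p.87] -/
theorem proj140_famB8OfRecordSubBP (β : ℝ) (len : B7Prop1Explicit.Site θ.D → ℝ) (i : IdxB8SubB θ) (α₂ : ℝ) (U₀ : (famB8OfRecordSubBP θ β len i).Cfg)
    (U₁ : (famB8OfRecordSubBP θ β len i).Pert) (h : (famB8OfRecordSubBP θ β len i).C140 α₂ U₀ U₁) : (famB8OfRecordSubBP θ β len i).C162 1 α₂ U₀ U₁ :=
  proj140_famB8OfRecord β len i.1 α₂ U₀ U₁ h

/-- **THE CARRIER LAW (1.36) ⊂ (1.62) HOLDS AT THE P-MEMBERS** (g31's `C136_C162_famB8OfRecord` BY NAME; the law under which the typed leaf implies the surviving one).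
[cite: Balaban1985RegularSpaces, (1.36) p.82, (1.62) p.87] -/
theorem C136_C162_famB8OfRecordSubBP (β : ℝ) (len : B7Prop1Explicit.Site θ.D → ℝ) (i : IdxB8SubB θ) (b b₂ s : ℝ) (U₀ : (famB8OfRecordSubBP θ β len i).Cfg)
    (U₁ : (famB8OfRecordSubBP θ β len i).Pert) (h : (famB8OfRecordSubBP θ β len i).C136 b b₂ s U₀ U₁) : (famB8OfRecordSubBP θ β len i).C162 b s U₀ U₁ :=
  C136_C162_famB8OfRecord β len i.1 b b₂ s U₀ U₁ h

end FamilyP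

/-! ## §2. The [B8] group of record on the P-carrier, substituted into a bundle; the surviving leaf over it; `rfl` faces -/

section SubIndexBP

variable {θ : Stage3Params}

/-- **THE [B8] GROUP OF RECORD OVER THE FOUR-LAW SUB-INDEX, READ AT THE P-MEMBERS, substituted into a carrier bundle**: n05-c g6's `withB8OfRecordSubBH` VERBATIM
with the family `famB8OfRecordSubBH ↦ famB8OfRecordSubBP` (index `I8b := IdxB8SubB θ`, R-extension read at the P-members, Proposition 7's axial map through
`Subtype.val`; SAME residual layer `lam : ResidB8 θ`); every other group of `X` unchanged.
[cite: Balaban1985RegularSpaces, Lemma 1 p.79 – Thm 8 p.101 (the carriers of the typed statements); (1.31) ∕ (1.35) ∕ (1.37) p.82, p.77 (the printed bond classes)] -/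
def _root_.Literature.MathematicalPhysics.QuantumFieldTheory.Balaban1983to89.DagBinding.PrintedCarriersR.withB8OfRecordSubBP (X : PrintedCarriersR)
    (θ : Stage3Params) (lam : ResidB8 θ) : PrintedCarriersR :=
  { X with
    I8a := B7Prop1Explicit.Site θ.D × Fin θ.D, I8b := IdxB8SubB θ, I8c := lam.I8c, I8d := lam.I8d, d8 := θ.D, L8 := θ.L,
    C₂ := lam.C₂, B₁' := lam.B₁', B₀' := lam.inp.B₀', B₁ := lam.B₁, B₂ := lam.B₂, c₁ := lam.c₁, inp8 := lam.inp, B₀β := lam.B₀β,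
    loc8 := blockPairNA θ.D θ.L θ.𝔸, fam8 := fun i => (famB8OfRecordSubBP θ lam.β lam.len i).toGFData2, lan8 := lam.lan, cub8 := lam.cub,
    toAxial8 := fun i => lam.toAxial i.1,
    C140 := fun i => (famB8OfRecordSubBP θ lam.β lam.len i).C140, InR := fun i => (famB8OfRecordSubBP θ lam.β lam.len i).InR,
    proj140 := fun i α₂ U₀ U₁ h => proj140_famB8OfRecordSubBP lam.β lam.len i α₂ U₀ U₁ h }

/-- **THE `b8` LEAF AT THE GROUP OF RECORD ON THE P-CARRIER, IN ITS SURVIVING FORM, OVER THE FOUR-LAW SUB-FAMILY** (Lemma 1 p. 79, Thm 2 p. 83, Prop. 3 p. 87,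
Thm 4 p. 88, Prop. 5 p. 94, Prop. 6 p. 99, Prop. 7 p. 100 faithful, Thm 8 p. 101 surviving at γ = 1 — with (1.35) ∕ (1.66) ∕ (1.37) ∕ (1.145) in print's bond classes
and Theorem 8's source space as printed).
[cite: Balaban1985RegularSpaces, Lemma 1 p.79, Thm 2 p.83, Prop. 3 p.87, Thm 4 p.88, Prop. 5 p.94, Prop. 6 p.99, Prop. 7 p.100, Thm 8 (1.146) p.101 (surviving form, GAPS G-B8-13)] -/
def B8LeafOfRecordSubBP (θ : Stage3Params) (lam : ResidB8 θ) : Prop :=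
  B8LeafRS θ.D (θ.L : ℝ) lam.C₂ lam.B₁' lam.inp.B₀' lam.B₁ lam.B₂ lam.c₁ lam.inp lam.B₀β (blockPairNA θ.D θ.L θ.𝔸)
    (fun j : IdxB8SubB θ => famB8OfRecordSubBP θ lam.β lam.len j) lam.lan lam.cub (fun j => lam.toAxial j.1)

/-- The surviving leaf over the SUBSTITUTED bundle's own [B8] group IS `B8LeafOfRecordSubBP θ lam` (`Iff.rfl`). [cite: Balaban1985RegularSpaces, Lemma 1 – Thm 8 pp.79–101 (bookkeeping)] -/
theorem b8LeafRS_withB8OfRecordSubBP_iff (X : PrintedCarriersR) (θ : Stage3Params) (lam : ResidB8 θ) :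
    B8LeafRS (X.withB8OfRecordSubBP θ lam).d8 (X.withB8OfRecordSubBP θ lam).L8 (X.withB8OfRecordSubBP θ lam).C₂ (X.withB8OfRecordSubBP θ lam).B₁'
        (X.withB8OfRecordSubBP θ lam).B₀' (X.withB8OfRecordSubBP θ lam).B₁ (X.withB8OfRecordSubBP θ lam).B₂ (X.withB8OfRecordSubBP θ lam).c₁
        (X.withB8OfRecordSubBP θ lam).inp8 (X.withB8OfRecordSubBP θ lam).B₀β (X.withB8OfRecordSubBP θ lam).loc8 (X.withB8OfRecordSubBP θ lam).fam8R
        (X.withB8OfRecordSubBP θ lam).lan8 (X.withB8OfRecordSubBP θ lam).cub8 (X.withB8OfRecordSubBP θ lam).toAxial8 ↔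
      B8LeafOfRecordSubBP θ lam :=
  Iff.rfl

/-- The [B8] substitution on the P-carrier AS TYPED (`DagBinding.B8LeafR` over the substituted bundle's own group) unfolded (`Iff.rfl`).
[cite: Balaban1985RegularSpaces, Lemma 1 – Thm 8 pp.79–101 (bookkeeping)] -/
theorem b8LeafR_withB8OfRecordSubBP_iff (X : PrintedCarriersR) (θ : Stage3Params) (lam : ResidB8 θ) :
    B8LeafR (X.withB8OfRecordSubBP θ lam).d8 (X.withB8OfRecordSubBP θ lam).L8 (X.withB8OfRecordSubBP θ lam).C₂ (X.withB8OfRecordSubBP θ lam).B₁'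
        (X.withB8OfRecordSubBP θ lam).B₀' (X.withB8OfRecordSubBP θ lam).B₁ (X.withB8OfRecordSubBP θ lam).B₂ (X.withB8OfRecordSubBP θ lam).c₁
        (X.withB8OfRecordSubBP θ lam).inp8 (X.withB8OfRecordSubBP θ lam).B₀β (X.withB8OfRecordSubBP θ lam).loc8 (X.withB8OfRecordSubBP θ lam).fam8R
        (X.withB8OfRecordSubBP θ lam).lan8 (X.withB8OfRecordSubBP θ lam).cub8 (X.withB8OfRecordSubBP θ lam).toAxial8 ↔
      B8LeafR θ.D (θ.L : ℝ) lam.C₂ lam.B₁' lam.inp.B₀' lam.B₁ lam.B₂ lam.c₁ lam.inp lam.B₀β (blockPairNA θ.D θ.L θ.𝔸)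
        (fun j : IdxB8SubB θ => famB8OfRecordSubBP θ lam.β lam.len j) lam.lan lam.cub (fun j => lam.toAxial j.1) :=
  Iff.rfl

/-- The substitution does not touch the [B10] group (`rfl`) … [cite: Balaban1985UV3, (1)–(5) p.256 (bookkeeping)] -/
theorem withB8OfRecordSubBP_runs10 (X : PrintedCarriersR) (θ : Stage3Params) (lam : ResidB8 θ) : (X.withB8OfRecordSubBP θ lam).runs10 = X.runs10 := rfl

/-- … nor the [B12 §§2–5] group (`rfl` ×2) … [cite: Balaban1987RG1, Lemma 4 p.280 (bookkeeping)] -/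
theorem withB8OfRecordSubBP_F12_c12 (X : PrintedCarriersR) (θ : Stage3Params) (lam : ResidB8 θ) :
    (X.withB8OfRecordSubBP θ lam).F12 = X.F12 ∧ (X.withB8OfRecordSubBP θ lam).c12 = X.c12 := ⟨rfl, rfl⟩

/-- … nor the [B13] group (`rfl` ×2) … [cite: Balaban1988RG2Cluster, Lemmas 1–3 pp.9–20 (bookkeeping)] -/
theorem withB8OfRecordSubBP_S13_c13 (X : PrintedCarriersR) (θ : Stage3Params) (lam : ResidB8 θ) :
    (X.withB8OfRecordSubBP θ lam).S13 = X.S13 ∧ (X.withB8OfRecordSubBP θ lam).c13 = X.c13 := ⟨rfl, rfl⟩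

/-- … commutes with the [B10] re-binding `withRuns10` (`rfl`) … [cite: Balaban1985UV3, (1)–(5) p.256 (bookkeeping)] -/
theorem withRuns10_withB8OfRecordSubBP (X : PrintedCarriersR) {J : Type} (r : J → B10.RunData) (θ : Stage3Params) (lam : ResidB8 θ) :
    (X.withRuns10 r).withB8OfRecordSubBP θ lam = (X.withB8OfRecordSubBP θ lam).withRuns10 r := rfl

/-- … with the [B12] substitution `withB12` (`rfl`) … [cite: Balaban1987RG1, Lemma 4 p.280 (bookkeeping)] -/
theorem withB12_withB8OfRecordSubBP (X : PrintedCarriersR) (F12 : B12Sec2to5.Lemma4Frame) (c12 : B12Sec2to5.Lemma4Consts) (θ : Stage3Params) (lam : ResidB8 θ) :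
    (X.withB12 F12 c12).withB8OfRecordSubBP θ lam = (X.withB8OfRecordSubBP θ lam).withB12 F12 c12 := rfl

/-- … and passes through the Stage-3 substitutions `carriers₃` (`rfl`). [cite: Balaban1984PropagatorsII, pp.223–250 (bookkeeping)] -/
theorem carriers₃_withB8OfRecordSubBP (θ₃ : Stage3Params) (X : PrintedCarriersR) (θ : Stage3Params) (lam : ResidB8 θ) :
    carriers₃ θ₃ (X.withB8OfRecordSubBP θ lam) = (carriers₃ θ₃ X).withB8OfRecordSubBP θ lam := rfl

/-- The P-pin substitutes the `GFData2` family of the P-carrier `zdGF3P` (`rfl`) — NOT the old pin's `fam8` (the three re-typed letters live in `GFData2`).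
[cite: Balaban1985RegularSpaces, (1.33)–(1.40) pp.82–83 (bookkeeping)] -/
theorem withB8OfRecordSubBP_fam8 (X : PrintedCarriersR) (θ : Stage3Params) (lam : ResidB8 θ) :
    (X.withB8OfRecordSubBP θ lam).fam8 = fun i : IdxB8SubB θ => (zdGF3P θ.𝔸 θ.L lam.β lam.len i.1.1).toGFData2 := rfl

/-- The P-pin and the H-pin substitute THE SAME source reading `InR` (`rfl`). [cite: Balaban1985RegularSpaces, (1.146) p.101 (bookkeeping)] -/
theorem withB8OfRecordSubBP_InR (X : PrintedCarriersR) (θ : Stage3Params) (lam : ResidB8 θ) :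
    (X.withB8OfRecordSubBP θ lam).InR = (X.withB8OfRecordSubBH θ lam).InR := rfl

/-- Non-vacuity of the pin's index (n05-c's `B8IdxB8LawsB.nonempty_idxB8SubB` BY NAME). [cite: Balaban1985RegularSpaces, p.77 («we admit Ω_j = T_η»)] -/
theorem nonempty_I8b_withB8OfRecordSubBP (X : PrintedCarriersR) (θ : Stage3Params) (lam : ResidB8 θ) : Nonempty (X.withB8OfRecordSubBP θ lam).I8b :=
  B8IdxB8LawsB.nonempty_idxB8SubB θ

end SubIndexBP

/-! ## §3. THE READING: the P-leaf = the old pin's four class-free conjuncts ∧ Thm 2 ∕ Prop 3 ∕ Thm 4 ∕ Prop 7 ∕ Thm 8 at the P-members; typed ⇒ surviving -/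

section ReadingP

variable {θ : Stage3Params}

/-- **THE READING OF THE P-SLOT**: `B8LeafOfRecordSubBP θ λ` ⟺ (Lemma 1 ∧ Prop 5 ∃ ∧ Prop 5 ! ∧ Prop 6 — the old pin's FOUR class-free conjuncts, STATED letter for letter as
the knits of record conclude them; every landed supplier transfers by `exact`) ∧ (Thm 2 ∧ Prop 3 ∧ Thm 4 ∧ Prop 7 ∧ Thm 8 surviving at γ = 1 AT THE P-MEMBERS — the
γ D-chain's targets on `zdGF3P` ∕ `zdGF3HP`).  No «OLD ⇒ NEW» or «NEW ⇒ OLD» at the slot: `C137` and `avgClose` sit in both variances of t2 ∕ t4 ∕ p7 ∕ t8.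
[cite: Balaban1985RegularSpaces, Lemma 1 p.79, Thm 2 p.83, Prop. 3 p.87, Thm 4 p.88, Prop. 5 p.94, Prop. 6 p.99, Prop. 7 p.100, Thm 8 (1.146) p.101] -/
theorem b8LeafOfRecordSubBP_iff_classFree_and_P (lam : ResidB8 θ) :
    B8LeafOfRecordSubBP θ lam ↔
      (B8.Lemma1Printed θ.D (blockPairNA θ.D θ.L θ.𝔸) ∧
        B8.Prop5Exists lam.inp.B₀' lam.B₁ lam.lan ∧ B8.Prop5Unique lam.lan ∧ B8.Prop6Printed θ.D (θ.L : ℝ) lam.B₁ lam.c₁ lam.cub) ∧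
      (B8.Thm2Printed (fun j : IdxB8SubB θ => (zdGF3P θ.𝔸 θ.L lam.β lam.len j.1.1).toGFData) ∧
        B8.Prop3Printed θ.D (θ.L : ℝ) lam.C₂ lam.inp lam.B₀β (fun j : IdxB8SubB θ => (zdGF3P θ.𝔸 θ.L lam.β lam.len j.1.1).toGFData2) ∧
        B8.Thm4Printed lam.B₁' (fun j : IdxB8SubB θ => (zdGF3P θ.𝔸 θ.L lam.β lam.len j.1.1).toGFData) ∧
        B8SectGH.Prop7PrintedR (fun j : IdxB8SubB θ => famB8OfRecordSubBP θ lam.β lam.len j) (fun j => lam.toAxial j.1) ∧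
        B8Thm8Surviving.Thm8SurvivingAt 1 lam.B₁ lam.B₂ (fun j : IdxB8SubB θ => famB8OfRecordSubBP θ lam.β lam.len j)) :=
  ⟨fun h => ⟨⟨h.l1, h.p5e, h.p5u, h.p6⟩, ⟨h.t2, h.p3, h.t4, h.p7, h.t8⟩⟩,
    fun ⟨⟨h1, h5e, h5u, h6⟩, ⟨h2, h3, h4, h7, h8⟩⟩ =>
      { l1 := h1, t2 := h2, p3 := h3, t4 := h4, p5e := h5e, p5u := h5u, p6 := h6, p7 := h7, t8 := h8 }⟩

/-- **CONSTRUCTOR OF THE P-SLOT FROM ITS NINE CONJUNCTS** (the knit faces' entry point: landed proofs of `l1 ∕ p5e ∕ p5u ∕ p6` go in unchanged, `t2 ∕ p3 ∕ t4 ∕ p7 ∕ t8` come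
from the γ D-chain on the P-carrier). [cite: Balaban1985RegularSpaces, Lemma 1 – Prop. 7 pp.79–100, Thm 8 (1.146) p.101] -/
theorem b8LeafOfRecordSubBP_of_fields (lam : ResidB8 θ) (l1 : B8.Lemma1Printed θ.D (blockPairNA θ.D θ.L θ.𝔸))
    (t2 : B8.Thm2Printed (fun j : IdxB8SubB θ => (zdGF3P θ.𝔸 θ.L lam.β lam.len j.1.1).toGFData))
    (p3 : B8.Prop3Printed θ.D (θ.L : ℝ) lam.C₂ lam.inp lam.B₀β (fun j : IdxB8SubB θ => (zdGF3P θ.𝔸 θ.L lam.β lam.len j.1.1).toGFData2))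
    (t4 : B8.Thm4Printed lam.B₁' (fun j : IdxB8SubB θ => (zdGF3P θ.𝔸 θ.L lam.β lam.len j.1.1).toGFData))
    (p5e : B8.Prop5Exists lam.inp.B₀' lam.B₁ lam.lan) (p5u : B8.Prop5Unique lam.lan) (p6 : B8.Prop6Printed θ.D (θ.L : ℝ) lam.B₁ lam.c₁ lam.cub)
    (p7 : B8SectGH.Prop7PrintedR (fun j : IdxB8SubB θ => famB8OfRecordSubBP θ lam.β lam.len j) (fun j => lam.toAxial j.1))
    (t8 : B8Thm8Surviving.Thm8SurvivingAt 1 lam.B₁ lam.B₂ (fun j : IdxB8SubB θ => famB8OfRecordSubBP θ lam.β lam.len j)) :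
    B8LeafOfRecordSubBP θ lam :=
  (b8LeafOfRecordSubBP_iff_classFree_and_P lam).2 ⟨⟨l1, p5e, p5u, p6⟩, ⟨t2, p3, t4, p7, t8⟩⟩

/-- **TYPED ⇒ SURVIVING over the P-sub-family** (`B8LeafKnitRS.b8LeafRS_of_b8LeafR` under `C136_C162_famB8OfRecordSubBP`): the leaf AS TYPED (`DagBinding.B8LeafR`,
`t8 :=` Thm 8 printed at γ = 1) over the P-group implies `B8LeafOfRecordSubBP`; never conversely. [cite: Balaban1985RegularSpaces, Thm 8 p.101 + (1.36) p.82 + (1.62) p.87 (bookkeeping)] -/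
theorem b8LeafOfRecordSubBP_of_b8LeafR (lam : ResidB8 θ)
    (h : B8LeafR θ.D (θ.L : ℝ) lam.C₂ lam.B₁' lam.inp.B₀' lam.B₁ lam.B₂ lam.c₁ lam.inp lam.B₀β (blockPairNA θ.D θ.L θ.𝔸)
      (fun j : IdxB8SubB θ => famB8OfRecordSubBP θ lam.β lam.len j) lam.lan lam.cub (fun j => lam.toAxial j.1)) :
    B8LeafOfRecordSubBP θ lam :=
  B8LeafKnitRS.b8LeafRS_of_b8LeafR (C136_C162_famB8OfRecordSubBP lam.β lam.len) h

/-- The Theorem-8 conjunct of the P-slot, projected (the target of dag-n05-d's D7 Thm-8 source chain on `zdGF3HP` at `ι := (·.1.1)`). [cite: Balaban1985RegularSpaces, Thm 8 (1.146) p.101] -/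
theorem B8LeafOfRecordSubBP.t8HP {lam : ResidB8 θ} (h : B8LeafOfRecordSubBP θ lam) :
    B8Thm8Surviving.Thm8SurvivingAt 1 lam.B₁ lam.B₂ (fun j : IdxB8SubB θ => zdGF3HP θ.𝔸 θ.L lam.β lam.len j.1.1) :=
  h.t8

/-- The Proposition-3 conjunct of the P-slot, projected on the `GFData2` family of `zdGF3P` (the target of dag-n05-d's D3 on n05-w1's `prop3_kLevel_γ`).
[cite: Balaban1985RegularSpaces, Prop. 3 p.87] -/
theorem B8LeafOfRecordSubBP.p3P {lam : ResidB8 θ} (h : B8LeafOfRecordSubBP θ lam) :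
    B8.Prop3Printed θ.D (θ.L : ℝ) lam.C₂ lam.inp lam.B₀β (fun j : IdxB8SubB θ => (zdGF3P θ.𝔸 θ.L lam.β lam.len j.1.1).toGFData2) :=
  h.p3

/-- The Theorem-4 conjunct of the P-slot, projected on the `GFData` family of `zdGF3P` (the target of n05-w2's D4). [cite: Balaban1985RegularSpaces, Thm 4 p.88] -/
theorem B8LeafOfRecordSubBP.t4P {lam : ResidB8 θ} (h : B8LeafOfRecordSubBP θ lam) :
    B8.Thm4Printed lam.B₁' (fun j : IdxB8SubB θ => (zdGF3P θ.𝔸 θ.L lam.β lam.len j.1.1).toGFData) :=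
  h.t4

/-- The Theorem-2 conjunct of the P-slot, projected (the target of n05-w2's D5). [cite: Balaban1985RegularSpaces, Thm 2 p.83] -/
theorem B8LeafOfRecordSubBP.t2P {lam : ResidB8 θ} (h : B8LeafOfRecordSubBP θ lam) :
    B8.Thm2Printed (fun j : IdxB8SubB θ => (zdGF3P θ.𝔸 θ.L lam.β lam.len j.1.1).toGFData) :=
  h.t2

end ReadingP

/-! ## §4. The CUT residual layer (dag-n05-d's `ResidB8.cutSubB`, reused): the P-slot there reads the knits' conclusion at the P-members -/

section CutLayerP

variable {θ : Stage3Params}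

/-- **THE P-SLOT AT THE CUT LAYER READS THE KNITS' CONCLUSION LETTER FOR LETTER** (`Iff.rfl`): `B8LeafOfRecordSubBP θ (λ.cutSubB J lan c₁)` is the surviving leaf over
`famB8OfRecordSubBP θ λ.β λ.len`, Prop. 5 at `lan`, Prop. 6 at `fun j : IdxB8SubB θ => cubB8OfRecord θ j.1`, the axial map through `·.1`, threshold `c₁`.
[cite: Balaban1985RegularSpaces, Lemma 1 – Thm 8 pp.79–101 (bookkeeping)] -/
theorem b8LeafOfRecordSubBP_cutSubB_iff (lam : ResidB8 θ) (J : Type) (lan : J → B8.LandauData) (c₁ : ℝ) :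
    B8LeafOfRecordSubBP θ (lam.cutSubB J lan c₁) ↔
      B8LeafRS θ.D (θ.L : ℝ) lam.C₂ lam.B₁' lam.inp.B₀' lam.B₁ lam.B₂ c₁ lam.inp lam.B₀β (blockPairNA θ.D θ.L θ.𝔸)
        (fun j : IdxB8SubB θ => famB8OfRecordSubBP θ lam.β lam.len j) lan (fun j : IdxB8SubB θ => cubB8OfRecord θ j.1) (fun j => lam.toAxial j.1) :=
  Iff.rfl

/-- **THE P-SLOT AT THE CUT LAYER, READ**: the four class-free conjuncts (Prop. 5 at `lan`, Prop. 6 at the law-cut cubes, threshold `c₁`) ∧ the five P-conjuncts at the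
P-members with constants `λ.B₁', λ.C₂, λ.B₁, λ.B₂` (`b8LeafOfRecordSubBP_iff_classFree_and_P` at the cut layer; the cut does not touch `β, len, B₁', B₁, B₂`).
[cite: Balaban1985RegularSpaces, Lemma 1 – Thm 8 pp.79–101 (bookkeeping)] -/
theorem b8LeafOfRecordSubBP_cutSubB_iff_classFree_and_P (lam : ResidB8 θ) (J : Type) (lan : J → B8.LandauData) (c₁ : ℝ) :
    B8LeafOfRecordSubBP θ (lam.cutSubB J lan c₁) ↔
      (B8.Lemma1Printed θ.D (blockPairNA θ.D θ.L θ.𝔸) ∧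
        B8.Prop5Exists lam.inp.B₀' lam.B₁ lan ∧ B8.Prop5Unique lan ∧
        B8.Prop6Printed θ.D (θ.L : ℝ) lam.B₁ c₁ (fun j : IdxB8SubB θ => cubB8OfRecord θ j.1)) ∧
      (B8.Thm2Printed (fun j : IdxB8SubB θ => (zdGF3P θ.𝔸 θ.L lam.β lam.len j.1.1).toGFData) ∧
        B8.Prop3Printed θ.D (θ.L : ℝ) lam.C₂ lam.inp lam.B₀β (fun j : IdxB8SubB θ => (zdGF3P θ.𝔸 θ.L lam.β lam.len j.1.1).toGFData2) ∧
        B8.Thm4Printed lam.B₁' (fun j : IdxB8SubB θ => (zdGF3P θ.𝔸 θ.L lam.β lam.len j.1.1).toGFData) ∧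
        B8SectGH.Prop7PrintedR (fun j : IdxB8SubB θ => famB8OfRecordSubBP θ lam.β lam.len j) (fun j => lam.toAxial j.1) ∧
        B8Thm8Surviving.Thm8SurvivingAt 1 lam.B₁ lam.B₂ (fun j : IdxB8SubB θ => famB8OfRecordSubBP θ lam.β lam.len j)) :=
  b8LeafOfRecordSubBP_iff_classFree_and_P (lam.cutSubB J lan c₁)

end CutLayerP

/-! ## §5. Non-vacuity of the source reading AT THE P-PIN: the refuting sources of record are rejected at every member; `f = 0` is admitted -/

section RejectedAtPinP

variable {θ : Stage3Params}

/-- **A source with a non-Hermitian value is NOT admitted at any member of the P-pin** (p501857's witness is not a Theorem-8 datum here).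
[cite: Balaban1985RegularSpaces, Thm 8 (1.146) p.101 («𝔤-valued»)] -/
theorem not_inR_famB8OfRecordSubBP_of_not_isSelfAdjoint (β : ℝ) (len : B7Prop1Explicit.Site θ.D → ℝ) (i : IdxB8SubB θ)
    (U₀ : (famB8OfRecordSubBP θ β len i).Cfg) {f : B7Prop1Explicit.Site θ.D → θ.𝔸} {x : B7Prop1Explicit.Site θ.D} (hx : ¬ IsSelfAdjoint (f x)) :
    ¬ (famB8OfRecordSubBP θ β len i).InR U₀ f :=
  B8LeafModelZd3H.not_inR_zdGF3H_of_not_isSelfAdjoint (β := β) (len := len) i.1.1 U₀ hx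

/-- **An unbounded source is NOT admitted at any member of the P-pin** (p503878's dipole train is not a Theorem-8 datum here).
[cite: Balaban1985RegularSpaces, p.86 (definition after (1.55))] -/
theorem not_inR_famB8OfRecordSubBP_of_not_bdd (β : ℝ) (len : B7Prop1Explicit.Site θ.D → ℝ) (i : IdxB8SubB θ) (U₀ : (famB8OfRecordSubBP θ β len i).Cfg)
    {f : B7Prop1Explicit.Site θ.D → θ.𝔸} (hf : ¬ B8ScaledSupNorm.Bdd θ.L i.1.1.k i.1.1.η (-(2 : ℝ)) (fun j (x : B7Prop1Explicit.Site θ.D) => x ∈ i.1.1.Ω j) f) :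
    ¬ (famB8OfRecordSubBP θ β len i).InR U₀ f :=
  B8LeafModelZd3H.not_inR_zdGF3H_of_not_bdd (β := β) (len := len) i.1.1 U₀ hf

/-- **An admitted source at a member of the P-pin has a bounded weighted family**. [cite: Balaban1985RegularSpaces, p.86 (definition after (1.55))] -/
theorem bdd_of_inR_famB8OfRecordSubBP (β : ℝ) (len : B7Prop1Explicit.Site θ.D → ℝ) (i : IdxB8SubB θ) (U₀ : (famB8OfRecordSubBP θ β len i).Cfg)
    {f : B7Prop1Explicit.Site θ.D → θ.𝔸} (h : (famB8OfRecordSubBP θ β len i).InR U₀ f) :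
    B8ScaledSupNorm.Bdd θ.L i.1.1.k i.1.1.η (-(2 : ℝ)) (fun j (x : B7Prop1Explicit.Site θ.D) => x ∈ i.1.1.Ω j) f :=
  B8LeafModelZd3H.bdd_of_inR_zdGF3H (β := β) (len := len) i.1.1 U₀ h

/-- **An admitted source at a member of the P-pin is Hermitian-valued**. [cite: Balaban1985RegularSpaces, Thm 8 (1.146) p.101 («𝔤-valued»)] -/
theorem isSelfAdjoint_of_inR_famB8OfRecordSubBP (β : ℝ) (len : B7Prop1Explicit.Site θ.D → ℝ) (i : IdxB8SubB θ) (U₀ : (famB8OfRecordSubBP θ β len i).Cfg)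
    {f : B7Prop1Explicit.Site θ.D → θ.𝔸} (h : (famB8OfRecordSubBP θ β len i).InR U₀ f) (x : B7Prop1Explicit.Site θ.D) : IsSelfAdjoint (f x) :=
  h.2.1 x

/-- **Non-vacuity of the source membership at the P-pin: `f = 0 ∈ R(U₀)`** at every member and every `U₀`. [cite: Balaban1985RegularSpaces, (1.146) p.101, (1.38) p.82] -/
theorem inR_famB8OfRecordSubBP_zero (β : ℝ) (len : B7Prop1Explicit.Site θ.D → ℝ) (i : IdxB8SubB θ) (U₀ : (famB8OfRecordSubBP θ β len i).Cfg) :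
    (famB8OfRecordSubBP θ β len i).InR U₀ (0 : B7Prop1Explicit.Site θ.D → θ.𝔸) :=
  B8LeafModelZd3H.inR_zdGF3H_zero (β := β) (len := len) i.1.1 U₀

end RejectedAtPinP

#print axioms b8LeafOfRecordSubBP_iff_classFree_and_P
#print axioms b8LeafOfRecordSubBP_of_b8LeafR

end Literature.MathematicalPhysics.QuantumFieldTheory.Balaban1983to89.Node00

end
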